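import Mathlib.Analysis.SpecialFunctions.Pow.Real
import HarnessLib

/-!
# `PeriodicStarCoercivity` (route `ReggeStarCoercivity`, stmt-AtomisticToContinuum-13602), line `pinned-equilibria-reduction`:
stub `stub_rpowBound` — the boundary allowance of a trial block is `O(K²)`

Registered stub of the line.  The torus crux 13602 is proved from its dependency 13600 (`StarCoercivity`:
`N·e_per + g·#Def(x) − C·N^{2/3} ≤ E_LJ(x)` for finite injective `x`) by trial `K`-blocks of a periodic
configuration; such a block has `N = m·K³` points (`m = #motif ≥ 1`), and the glue needs the boundary allowance
`C·N^{2/3}` to be `o(K³)`.  This file is the elementary real-analysis bound used there: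
`(m K³)^{2/3} = m^{2/3} K² ≤ m K²` for `1 ≤ m`, with the real exponent `(2 / 3 : ℝ)` (`Real.rpow`).

Proof: `Real.mul_rpow` splits the product; `((K:ℝ)^3)^(2/3) = (K:ℝ)^(3·(2/3)) = (K:ℝ)^2`
(`Real.rpow_natCast_mul`, `Real.rpow_two`); and `m^(2/3) ≤ m^1 = m` since `1 ≤ m`
(`Real.rpow_le_rpow_of_exponent_le`, `Real.rpow_one`).  All `[folklore]`.
-/

noncomputable section

namespace Summit.AtomisticToContinuum.Crystallization.Theorems.ReggeStarCoercivityPeriodicStarCoercivity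

/-- **Stub `stub_rpowBound` of the line `pinned-equilibria-reduction`** (crux
`ReggeStarCoercivity.PeriodicStarCoercivity`, stmt-AtomisticToContinuum-13602): for natural numbers `m, K` with
`1 ≤ m`, `(m · K³)^{2/3} ≤ m · K²` as real numbers (real exponent `2/3`).  Indeed
`(m K³)^{2/3} = m^{2/3} · K²` (`Real.mul_rpow`, `Real.rpow_natCast_mul`) and `m^{2/3} ≤ m^1 = m` because `1 ≤ m`
(`Real.rpow_le_rpow_of_exponent_le`).  [folklore] -/
theorem stub_rpowBound : ∀ (m K : ℕ), 1 ≤ m →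
    ((m : ℝ) * (K : ℝ) ^ 3) ^ (2 / 3 : ℝ) ≤ (m : ℝ) * (K : ℝ) ^ 2 := by
  intro m K hm
  have hm0 : (0 : ℝ) ≤ (m : ℝ) := Nat.cast_nonneg _
  have hm1 : (1 : ℝ) ≤ (m : ℝ) := by exact_mod_cast hm
  have hK0 : (0 : ℝ) ≤ (K : ℝ) := Nat.cast_nonneg _
  have hK3 : (0 : ℝ) ≤ (K : ℝ) ^ 3 := by positivity
  -- second factor: `((K:ℝ)^3)^(2/3) = (K:ℝ)^2`
  have hKpow : ((K : ℝ) ^ 3) ^ (2 / 3 : ℝ) = (K : ℝ) ^ 2 := by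
    rw [← Real.rpow_natCast_mul hK0 3 (2 / 3 : ℝ), ← Real.rpow_two]
    norm_num
  -- first factor: `(m:ℝ)^(2/3) ≤ m`
  have hmpow : (m : ℝ) ^ (2 / 3 : ℝ) ≤ (m : ℝ) := by
    calc (m : ℝ) ^ (2 / 3 : ℝ) ≤ (m : ℝ) ^ (1 : ℝ) :=
          Real.rpow_le_rpow_of_exponent_le hm1 (by norm_num)
      _ = (m : ℝ) := Real.rpow_one _
  rw [Real.mul_rpow hm0 hK3, hKpow]
  exact mul_le_mul_of_nonneg_right hmpow (by positivity)

end Summit.AtomisticToContinuum.Crystallization.Theorems.ReggeStarCoercivityPeriodicStarCoercivity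

end
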